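import Literature.Analysis.FluidPDE.ForcedOseenRepresentation
import Literature.Analysis.FluidPDE.NSLerayBlowupRateLpProofs
import Literature.Analysis.FluidPDE.TaoForcedFiniteEnergyLerayHopfL2
import HarnessLib

/-!
# The forced Oseen representation of bounded classical finite-energy solutions on `ℝ³`, and its
# pointwise consequences: the heat + Volterra + force inequality and the forced short-time sup bound

Analysis/FluidPDE proof file (theorems only; no definitions, no named facts). Companion of
`ForcedOseenRepresentation.lean` (the representation
`u(t) = e^{νtΔ}u(0) - B^ν_0(u,u)(t) + ∫₀ᵗ e^{ν(t-τ)Δ} g(τ) dτ` for bounded duality-form mild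
solutions driven by a bounded divergence-free force `g`). Here the representation is fed with a
CLASSICAL solution: a classical solution `(u, p)` of the Navier–Stokes system on the closed slab
`[0, T] × ℝ³` (`ν > 0`) driven by a jointly continuous force `g` with bounded, weakly
divergence-free, uniformly square-integrable slices (the PROJECTED force `P f` of a Clay-class force
`f` is of this kind — Tao 2013, (7)–(8): the gradient part `∇Δ⁻¹∇·f` of the force is carried by the
normalised pressure), with finite energy and bounded velocity, is Leray–Hopf from `u(0)` with force
`g` (`IsClassicalNSSolutionOn.isLerayHopfOn_of_finiteEnergy_forced_L2`, Tao 2013 Lemma 8.1 with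
force), hence duality-form mild (`IsLerayHopfOn.isMildNSSolutionOn_Ioc_forced`,
Fabes–Jones–Rivière 1972 Thm. 2.1), hence Oseen-mild (`ae_eq_forced_oseenMild_of_bounded`,
Lemarié-Rieusset 2016 Thm. 6.1 / Prop. 6.5):

* `IsClassicalNSSolutionOn.ae_eq_forced_oseenMild` — the representation, a.e. in `x`, for every
  `t ∈ (0, T]`;
* `IsClassicalNSSolutionOn.norm_le_heat_add_volterra_add_force` — **the heat + Volterra + force
  inequality** (forced twin of `exists_norm_le_heat_add_volterra`, Ożański–Pooley 2018 (6.65) with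
  Lemma 6.9 (i); Leray 1934 §21 (3.5)): if `‖u(τ, ·)‖ ≤ V(τ) ≤ M` on `[0, T]`, `‖u(0)‖_{Lʳ} ≤ N`
  (`1 ≤ r`) and `‖g(τ, ·)‖ ≤ G`, then for `0 < s ≤ T` and every `x`
  `‖u(s, x)‖ ≤ N (νs)^{-3/(2r)} + C₁ ν^{-1/2} ∫_{(0,s)} (s - τ)^{-1/2} V(τ)² dτ + s G`,
  `C₁` the universal constant of the weighted Duhamel bound
  (`exists_enorm_oseenDuhamel_weighted_le`);
* `IsClassicalNSSolutionOn.norm_le_sup_add_sqrt_add_force` — **the forced short-time sup bound**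
  (the cell `ns-blowup`'s «Hmin», memo EC-BRIDGE-v5 §4(b); Leray 1934 §19 (3.4)/(3.8) with force;
  Lemarié-Rieusset 2016, Thm. 11.2 (11.11) mechanism): if `‖u‖ ≤ M` on `[0, T] × ℝ³`,
  `‖u(0, ·)‖ ≤ A` and `‖g‖ ≤ G` on the slab, then for `0 < s ≤ T` and every `x`
  `‖u(s, x)‖ ≤ A + 2 C_B M² ν^{-1/2} √s + s G`, `C_B` the universal constant of
  `exists_norm_oseenDuhamel_bounded_le`.

Cell `ns-blowup` labels: LABEL Literature port; bears_on LADDER-NS N1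
(route-NavierStokesRegularity-PalasekTowerBreakdown: child crux stmt-NavierStokesRegularity-19249
via the E–C cone — R5 `lemarieRieusset2016_lerayRate_forced`, and the base crux 19179 via the
hold-and-release trap of memo EC-BRIDGE-v5 §4(b)); WHAT THIS IS NOT: not NS — pointwise bounds
for GIVEN bounded classical solutions of the forced system over short times; nothing about
regularity or blow-up is asserted.

## Mathlib / tree search

Tree: `ae_eq_forced_oseenMild_of_bounded`, `IsLerayHopfOn.isMildNSSolutionOn_Ioc_forced`,
`norm_forceDuhamel_le` (`ForcedOseenRepresentation`);
`IsClassicalNSSolutionOn.isLerayHopfOn_of_finiteEnergy_forced_L2` (`TaoForcedFiniteEnergyLerayHopfL2`);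
`exists_enorm_oseenDuhamel_weighted_le`, `exists_norm_oseenDuhamel_bounded_le`,
`eLpNorm_top_heatExtension_le_of_Lr`, `forall_norm_le_of_ae_norm_le`, `integrableOn_sub_rpow_Ioo`
(`NSLerayOseenRepresentation`, `NSBoundedMildOseenDuhamel`, `NSLerayBlowupRateLpProofs`,
`LerayVolterraComparison`); `IsLerayHopfOn.memLp`, `VectorCalculus.IsDivFree.isWeaklyDivFree_holds`.
The unforced twin is `exists_norm_le_heat_add_volterra` (`NSLerayBlowupRateLpProofs`); no forced
version existed (`lean search 'heat_add_volterra|ShortTimeSupBound'`: `ClassicalShortTimeSupBound`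
is unforced).

## References

* P. G. Lemarié-Rieusset, *The Navier–Stokes Problem in the 21st Century*, CRC Press (2016),
  Thm. 6.1 with Prop. 6.5 (pp. 133–136), Thm. 11.2 (11.11), Thm. 11.4 (p. 327). [LemarieRieusset2016]
* W. S. Ożański, B. C. Pooley, in: LMS Lecture Note Ser. 452, CUP 2018 = arXiv:1708.09787, Lemma
  6.9 (i), (6.55), (6.65), Lemma 6.23 (iii). [OzanskiPooley2018]
* J. Leray, Acta Math. 63 (1934), §19 (3.4)–(3.8), §21 (3.5). [Leray1934]
* T. Tao, Anal. PDE 6 (2013) = arXiv:1108.1165, (7)–(8), (9.2), Lemma 8.1. [Tao2011]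
* E. B. Fabes, B. F. Jones, N. M. Rivière, ARMA 45 (1972), Thm. 2.1. [FabesJonesRiviere1972]
-/

noncomputable section

open MeasureTheory TopologicalSpace Set Function Filter
open _root_.Topology
open scoped InnerProductSpace RealInnerProductSpace ENNReal NNReal

namespace Literature.Analysis.FluidPDE

section Classical

variable {ν T M G : ℝ} {g u : ℝ → EuclideanSpace ℝ (Fin 3) → EuclideanSpace ℝ (Fin 3)}
  {p : ℝ → EuclideanSpace ℝ (Fin 3) → ℝ}

/-- The slab `L²` norm of a jointly continuous force with uniformly square-integrable slices is
finite: `‖g‖_{L²((0,T) × ℝ³)} ≤ √T · G₂ < ∞`. [folklore] -/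
private theorem eLpNorm_uncurry_prod_lt_top_of_slices (hgc : Continuous (uncurry g))
    {G₂ : ℝ≥0∞} (hG₂ : G₂ ≠ ⊤) (hg2 : ∀ τ ∈ Icc 0 T, eLpNorm (g τ) 2 volume ≤ G₂) :
    eLpNorm (uncurry g) 2 (((volume : Measure ℝ).restrict (Ioo 0 T)).prod
      (volume : Measure (EuclideanSpace ℝ (Fin 3)))) < ⊤ := by
  set μ : Measure ℝ := (volume : Measure ℝ).restrict (Ioo 0 T) with hμ
  have hm : AEStronglyMeasurable (uncurry g) (μ.prod volume) := hgc.aestronglyMeasurable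
  rw [eLpNorm_eq_lintegral_rpow_enorm_toReal two_ne_zero ENNReal.ofNat_ne_top, ENNReal.toReal_ofNat]
  simp only [one_div]
  refine ENNReal.rpow_lt_top_of_nonneg (by norm_num) (ne_of_lt ?_)
  rw [lintegral_prod _ (hm.enorm.pow_const _)]
  have hslice : ∀ τ ∈ Ioo 0 T, ∫⁻ x, ‖uncurry g (τ, x)‖ₑ ^ (2 : ℝ) ≤ G₂ ^ 2 := by
    intro τ hτ
    have h := hg2 τ ⟨hτ.1.le, hτ.2.le⟩
    rw [eLpNorm_eq_lintegral_rpow_enorm_toReal two_ne_zero ENNReal.ofNat_ne_top,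
      ENNReal.toReal_ofNat] at h
    simp only [one_div] at h
    have h' := ENNReal.rpow_le_rpow h (z := 2) (by norm_num)
    rw [← ENNReal.rpow_mul, show (2 : ℝ)⁻¹ * 2 = 1 by norm_num, ENNReal.rpow_one] at h'
    simpa using h'
  calc ∫⁻ τ, ∫⁻ x, ‖uncurry g (τ, x)‖ₑ ^ (2 : ℝ) ∂volume ∂μ ≤ ∫⁻ _τ, G₂ ^ 2 ∂μ := by
        rw [hμ]
        exact setLIntegral_mono' measurableSet_Ioo fun τ hτ => hslice τ hτ
    _ = G₂ ^ 2 * ENNReal.ofReal T := by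
        rw [lintegral_const, hμ, Measure.restrict_apply_univ, Real.volume_Ioo, sub_zero]
    _ < ⊤ := ENNReal.mul_lt_top (ENNReal.pow_lt_top hG₂.lt_top) ENNReal.ofReal_lt_top

/-- **The forced Oseen representation of a bounded classical finite-energy solution.** Let `(u, p)`
be a classical solution of the Navier–Stokes system on `[0, T] × ℝ³` (`ν > 0`, `T > 0`) driven by a
jointly continuous force `g` whose slices on `[0, T]` are bounded by `G`, weakly divergence free and
square integrable with `‖g(τ)‖₂ ≤ G₂ < ∞` (e.g. the projected force `P f` of a Clay-class force),
with finite energy `sup_t ∫|u(t)|² < ∞` and `‖u‖ ≤ M` on the slab. Then for every `t ∈ (0, T]`,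
`u(t) = e^{νtΔ}u(0) - B^ν_0(u,u)(t) + ∫₀ᵗ e^{ν(t-τ)Δ} g(τ) dτ` a.e. (Lemarié-Rieusset 2016, Thm. 6.1
with Prop. 6.5, fed by the forced Leray–Hopf packaging of Tao 2013, Lemma 8.1 and the duality form
of Fabes–Jones–Rivière 1972, Thm. 2.1). [cite: LemarieRieusset2016, Thm. 6.1 with Prop. 6.5 (pp. 133–136)]
[cite: Tao2011, (9.2) with Lemma 8.1] -/
theorem IsClassicalNSSolutionOn.ae_eq_forced_oseenMild
    (hcl : IsClassicalNSSolutionOn (Icc 0 T) ν g u p) (hν : 0 < ν) (hT : 0 < T)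
    (hgc : Continuous (uncurry g)) (hG : ∀ τ ∈ Icc 0 T, ∀ y, ‖g τ y‖ ≤ G)
    (hgdiv : ∀ τ ∈ Icc 0 T, IsWeaklyDivFree (g τ)) {G₂ : ℝ≥0∞} (hG₂ : G₂ ≠ ⊤)
    (hg2 : ∀ τ ∈ Icc 0 T, eLpNorm (g τ) 2 volume ≤ G₂)
    (hE : ∃ C : ℝ≥0∞, C < ⊤ ∧ ∀ t ∈ Icc 0 T, ∫⁻ x, ‖u t x‖ₑ ^ 2 ≤ C)
    (hM : 0 < M) (hbd : ∀ t ∈ Icc 0 T, ∀ y, ‖u t y‖ ≤ M) {t : ℝ} (ht : t ∈ Ioc 0 T) :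
    u t =ᵐ[volume] fun x =>
      UnboundedOperators.heatExtension (u 0) (ν * t) x - oseenDuhamel ν 0 u u t x +
        forceDuhamel ν 0 g t x := by
  have h0I : (0 : ℝ) ∈ Icc 0 T := ⟨le_rfl, hT.le⟩
  -- ### the force: measurability and slab norms
  have hgm : StronglyMeasurable (uncurry g) := hgc.stronglyMeasurable
  have hgslc : ∀ τ, Continuous (g τ) := fun τ => hgc.comp (continuous_const.prodMk continuous_id)
  have hg2' : ∀ τ ∈ Icc 0 T, MemLp (g τ) 2 volume ∧ eLpNorm (g τ) 2 volume ≤ G₂ := fun τ hτ =>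
    ⟨⟨(hgslc τ).aestronglyMeasurable, (hg2 τ hτ).trans_lt hG₂.lt_top⟩, hg2 τ hτ⟩
  have hCf : ∀ τ ∈ Icc 0 T, ∫⁻ x, ‖g τ x‖ₑ ^ 2 ≤ G₂ ^ 2 := by
    intro τ hτ
    have h := hg2 τ hτ
    rw [eLpNorm_eq_lintegral_rpow_enorm_toReal two_ne_zero ENNReal.ofNat_ne_top,
      ENNReal.toReal_ofNat] at h
    simp only [one_div] at h
    have h' := ENNReal.rpow_le_rpow h (z := 2) (by norm_num)
    rw [← ENNReal.rpow_mul, show (2 : ℝ)⁻¹ * 2 = 1 by norm_num, ENNReal.rpow_one] at h'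
    simpa using h'
  have hfm : AEStronglyMeasurable (uncurry g) (((volume : Measure ℝ).restrict (Ioo 0 T)).prod
      (volume : Measure (EuclideanSpace ℝ (Fin 3)))) := hgc.aestronglyMeasurable
  have hf2 := eLpNorm_uncurry_prod_lt_top_of_slices hgc hG₂ hg2
  -- ### Leray–Hopf, then duality-form mild
  have hLH : IsLerayHopfOn T ν g (u 0) u :=
    (hcl.isLerayHopfOn_of_finiteEnergy_forced_L2 hν hT (ENNReal.pow_ne_top hG₂) hCf hE).1
  obtain ⟨A, hAt, hA⟩ := hE
  have h2 : ∀ t ∈ Icc 0 T, MemLp (u t) 2 volume := fun t ht => hLH.memLp t ht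
  have hMs : ∀ s ∈ Icc 0 T, eLpNorm (u s) 2 volume ≤ A ^ (1 / 2 : ℝ) := by
    intro s hs
    rw [eLpNorm_eq_lintegral_rpow_enorm_toReal two_ne_zero ENNReal.ofNat_ne_top, ENNReal.toReal_ofNat]
    have h := hA s hs
    have h' : ∫⁻ x, ‖u s x‖ₑ ^ (2 : ℝ) ≤ A := by simpa using h
    exact ENNReal.rpow_le_rpow h' (by norm_num)
  have hmild : IsMildNSSolutionOn (Ioc 0 T) ν g (u 0) u :=
    hLH.isMildNSSolutionOn_Ioc_forced finrank_euclideanSpace_fin (h2 0 h0I) hν hT hfm hf2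
      (ENNReal.rpow_ne_top_of_nonneg (by norm_num) hAt.ne) hMs
  -- ### regularity of `u` on the closed strip
  have hcont : ContinuousOn (uncurry u) (Icc 0 T ×ˢ univ) := hcl.smooth_velocity.continuousOn
  have hslc : ∀ τ ∈ Icc 0 T, Continuous (u τ) := fun τ hτ =>
    (hcl.contDiff_velocity hτ).continuous
  have hsl : ∀ τ ∈ Icc 0 T, AEStronglyMeasurable (u τ) volume := fun τ hτ =>
    (hslc τ hτ).aestronglyMeasurable
  have hmeas : AEStronglyMeasurable (uncurry u)
      ((volume : Measure (ℝ × EuclideanSpace ℝ (Fin 3))).restrict (Ioo 0 T ×ˢ univ)) :=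
    (hcont.mono (prod_mono Ioo_subset_Icc_self Subset.rfl)).aestronglyMeasurable
      (measurableSet_Ioo.prod MeasurableSet.univ)
  have hdiv0 : IsWeaklyDivFree (u 0) :=
    VectorCalculus.IsDivFree.isWeaklyDivFree_holds (hcl.divFree 0 h0I)
      ((hcl.contDiff_velocity h0I).of_le (by norm_cast))
  -- ### the representation
  exact ae_eq_forced_oseenMild_of_bounded hν hT hmild hmeas hsl hM hbd hdiv0 h2 hgm
    (fun τ hτ => hG τ ⟨hτ.1.le, hτ.2.le⟩) (fun τ hτ => hgdiv τ ⟨hτ.1.le, hτ.2.le⟩) hG₂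
    (fun τ hτ => hg2' τ ⟨hτ.1.le, hτ.2.le⟩) ht

/-- **The heat + Volterra + force inequality for bounded classical solutions of the FORCED system**
(forced twin of `exists_norm_le_heat_add_volterra`; Ożański–Pooley 2018, (6.65) with Lemma 6.9 (i);
Leray 1934, §21 (3.5); Lemarié-Rieusset 2016, proof of Thm. 11.4/11.5: the mild formulation WITH the
force term `∫₀ᵗ e^{ν(t-s)Δ} Pf ds`). There is a universal `C₁ > 0` such that for every `ν > 0`,
`T > 0`, `r ≥ 1`, `N ≥ 0`, every classical solution `(u, p)` on `[0, T] × ℝ³` driven by a jointly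
continuous force `g` (slices bounded by `G`, weakly divergence free, `‖g(τ)‖₂ ≤ G₂ < ∞`), with
finite energy, `‖u(τ, ·)‖ ≤ V(τ) ≤ M` on `[0, T]` (`V ≥ 0` measurable) and `‖u(0)‖_{Lʳ} ≤ N`:
`‖u(s, x)‖ ≤ N (νs)^{-3/(2r)} + C₁ ν^{-1/2} ∫_{(0,s)} (s - τ)^{-1/2} V(τ)² dτ + s G` for all
`s ∈ (0, T]` and all `x` (heat term: `eLpNorm_top_heatExtension_le_of_Lr`; Duhamel term:
`exists_enorm_oseenDuhamel_weighted_le`; force term: `norm_forceDuhamel_le`; a.e. from the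
representation, everywhere by continuity of `u(s)`).
[cite: OzanskiPooley2018, (6.65) with Lemma 6.9 (i) and (6.55), pp. 129–143]
[cite: LemarieRieusset2016, Thm. 11.4 proof (p. 327) with Thm. 6.1] -/
theorem exists_norm_le_heat_add_volterra_add_force :
    ∃ C₁ : ℝ, 0 < C₁ ∧ ∀ {ν T M G r N : ℝ}
      {g u : ℝ → EuclideanSpace ℝ (Fin 3) → EuclideanSpace ℝ (Fin 3)}
      {p : ℝ → EuclideanSpace ℝ (Fin 3) → ℝ} {V : ℝ → ℝ} {G₂ : ℝ≥0∞},
      0 < ν → 0 < T → 1 ≤ r → 0 ≤ N →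
      IsClassicalNSSolutionOn (Icc 0 T) ν g u p → Continuous (uncurry g) →
      (∀ τ ∈ Icc 0 T, ∀ y, ‖g τ y‖ ≤ G) → (∀ τ ∈ Icc 0 T, IsWeaklyDivFree (g τ)) → G₂ ≠ ⊤ →
      (∀ τ ∈ Icc 0 T, eLpNorm (g τ) 2 volume ≤ G₂) →
      (∃ C : ℝ≥0∞, C < ⊤ ∧ ∀ t ∈ Icc 0 T, ∫⁻ x, ‖u t x‖ₑ ^ 2 ≤ C) →
      0 < M → (∀ s ∈ Icc 0 T, ∀ y, ‖u s y‖ ≤ M) →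
      Measurable V → (∀ τ, 0 ≤ V τ) → (∀ τ, V τ ≤ M) →
      (∀ τ ∈ Icc 0 T, ∀ y, ‖u τ y‖ ≤ V τ) →
      eLpNorm (u 0) (ENNReal.ofReal r) volume ≤ ENNReal.ofReal N →
      ∀ s ∈ Ioc 0 T, ∀ x,
        ‖u s x‖ ≤ N * (ν * s) ^ (-(3 / (2 * r))) +
          C₁ * ν ^ (-(1 / 2 : ℝ)) * (∫ τ in Ioo 0 s, (s - τ) ^ (-(1 / 2 : ℝ)) * V τ ^ 2) + s * G := by
  obtain ⟨C₁, hC₁, hDuh⟩ := exists_enorm_oseenDuhamel_weighted_le (E := EuclideanSpace ℝ (Fin 3))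
  refine ⟨C₁, hC₁, ?_⟩
  intro ν T M G r N g u p V G₂ hν hT hr hN hcl hgc hG hgdiv hG₂ hg2 hE hM hMb hVm hV0 hVM hVu hNr s hs x
  have hs0 : 0 < s := hs.1
  have hνs : 0 < ν * s := mul_pos hν hs0
  have hsI : s ∈ Icc 0 T := ⟨hs.1.le, hs.2⟩
  have h0I : (0 : ℝ) ∈ Icc 0 T := ⟨le_rfl, hT.le⟩
  -- ### regularity of `u` on the closed strip
  have hcont : ContinuousOn (uncurry u) (Icc 0 T ×ˢ univ) := hcl.smooth_velocity.continuousOn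
  have hslc : ∀ τ ∈ Icc 0 T, Continuous (u τ) := fun τ hτ =>
    (hcl.contDiff_velocity hτ).continuous
  have hsl : ∀ τ ∈ Icc 0 T, AEStronglyMeasurable (u τ) volume := fun τ hτ =>
    (hslc τ hτ).aestronglyMeasurable
  have hmeas : AEStronglyMeasurable (uncurry u)
      ((volume : Measure (ℝ × EuclideanSpace ℝ (Fin 3))).restrict (Ioo 0 T ×ˢ univ)) :=
    (hcont.mono (prod_mono Ioo_subset_Icc_self Subset.rfl)).aestronglyMeasurable
      (measurableSet_Ioo.prod MeasurableSet.univ)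
  -- ### the representation formula at time `s`
  have hrep := hcl.ae_eq_forced_oseenMild hν hT hgc hG hgdiv hG₂ hg2 hE hM hMb hs
  -- ### the heat term
  have ha0 : 0 ≤ N * (ν * s) ^ (-(3 / (2 * r))) := by positivity
  have hheat := eLpNorm_top_heatExtension_le_of_Lr (hsl 0 h0I) hr hN hNr hνs
  -- ### the Duhamel term
  have hCν0 : 0 ≤ C₁ * ν ^ (-(1 / 2 : ℝ)) := by positivity
  have hI0 : 0 ≤ ∫ τ in Ioo 0 s, (s - τ) ^ (-(1 / 2 : ℝ)) * V τ ^ 2 :=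
    setIntegral_nonneg measurableSet_Ioo fun τ hτ =>
      mul_nonneg (Real.rpow_nonneg (sub_nonneg.2 hτ.2.le) _) (sq_nonneg _)
  have hB : ∀ y, ‖oseenDuhamel ν 0 u u s y‖ ≤
      C₁ * ν ^ (-(1 / 2 : ℝ)) * ∫ τ in Ioo 0 s, (s - τ) ^ (-(1 / 2 : ℝ)) * V τ ^ 2 := by
    intro y
    have hVu' : ∀ τ ∈ Ioo 0 s, ∀ z, ‖u τ z‖ ≤ V τ := fun τ hτ z =>
      hVu τ ⟨hτ.1.le, hτ.2.le.trans hs.2⟩ z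
    have h1 := hDuh hν (u := u) (v := u) (s := 0) (t := s) (V := V) (fun τ _ => hV0 τ) hVu' hVu' y
    have hEq : EqOn (fun τ => C₁ * V τ ^ 2 * (ν * (s - τ)) ^ (-(1 / 2 : ℝ)))
        (fun τ => C₁ * ν ^ (-(1 / 2 : ℝ)) * ((s - τ) ^ (-(1 / 2 : ℝ)) * V τ ^ 2)) (Ioo 0 s) := by
      intro τ hτ
      show C₁ * V τ ^ 2 * (ν * (s - τ)) ^ (-(1 / 2 : ℝ)) =
        C₁ * ν ^ (-(1 / 2 : ℝ)) * ((s - τ) ^ (-(1 / 2 : ℝ)) * V τ ^ 2)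
      rw [Real.mul_rpow hν.le (sub_nonneg.2 hτ.2.le)]
      ring
    have hkern : IntegrableOn (fun τ => (s - τ) ^ (-(1 / 2 : ℝ)) * V τ ^ 2) (Ioo 0 s) := by
      refine Integrable.mul_bdd (c := M ^ 2) (integrableOn_sub_rpow_Ioo (by norm_num))
        ((hVm.pow_const 2).aestronglyMeasurable) (Eventually.of_forall fun τ => ?_)
      rw [Real.norm_of_nonneg (sq_nonneg _)]
      exact pow_le_pow_left₀ (hV0 τ) (hVM τ) 2
    have hint : IntegrableOn (fun τ => C₁ * V τ ^ 2 * (ν * (s - τ)) ^ (-(1 / 2 : ℝ))) (Ioo 0 s) :=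
      IntegrableOn.congr_fun (hkern.const_mul (C₁ * ν ^ (-(1 / 2 : ℝ)))) hEq.symm measurableSet_Ioo
    have hnn : 0 ≤ᵐ[volume.restrict (Ioo 0 s)]
        fun τ => C₁ * V τ ^ 2 * (ν * (s - τ)) ^ (-(1 / 2 : ℝ)) := by
      refine (ae_restrict_iff' measurableSet_Ioo).2 (Eventually.of_forall fun τ hτ => ?_)
      show (0 : ℝ) ≤ C₁ * V τ ^ 2 * (ν * (s - τ)) ^ (-(1 / 2 : ℝ))
      exact mul_nonneg (mul_nonneg hC₁.le (sq_nonneg _))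
        (Real.rpow_nonneg (mul_nonneg hν.le (sub_nonneg.2 hτ.2.le)) _)
    rw [← ofReal_integral_eq_lintegral_ofReal hint hnn, setIntegral_congr_fun measurableSet_Ioo hEq,
      integral_const_mul, ← ofReal_norm, ENNReal.ofReal_le_ofReal_iff (mul_nonneg hCν0 hI0)] at h1
    exact h1
  -- ### the force term
  have hsG : 0 ≤ s * G := mul_nonneg hs0.le ((norm_nonneg _).trans (hG 0 h0I 0))
  have hF : ∀ y, ‖forceDuhamel ν 0 g s y‖ ≤ s * G := by
    intro y
    have h := norm_forceDuhamel_le (g := g) hν hs0.le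
      (fun τ hτ z => hG τ ⟨hτ.1.le, hτ.2.le.trans hs.2⟩ z) y
    simpa using h
  -- ### the bound a.e., then everywhere by continuity of `u s`
  have hae : ∀ᵐ y ∂(volume : Measure (EuclideanSpace ℝ (Fin 3))),
      ‖u s y‖ ≤ N * (ν * s) ^ (-(3 / (2 * r))) +
        C₁ * ν ^ (-(1 / 2 : ℝ)) * (∫ τ in Ioo 0 s, (s - τ) ^ (-(1 / 2 : ℝ)) * V τ ^ 2) + s * G := by
    have hh := ae_le_eLpNormEssSup (f := UnboundedOperators.heatExtension (u 0) (ν * s))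
      (μ := (volume : Measure (EuclideanSpace ℝ (Fin 3))))
    rw [eLpNorm_exponent_top] at hheat
    filter_upwards [hrep, hh] with y hy hy'
    rw [hy]
    have hh1 :
        ‖UnboundedOperators.heatExtension (u 0) (ν * s) y‖ ≤ N * (ν * s) ^ (-(3 / (2 * r))) := by
      have := hy'.trans hheat
      rwa [← ofReal_norm, ENNReal.ofReal_le_ofReal_iff ha0] at this
    calc ‖UnboundedOperators.heatExtension (u 0) (ν * s) y - oseenDuhamel ν 0 u u s y +
          forceDuhamel ν 0 g s y‖
        ≤ ‖UnboundedOperators.heatExtension (u 0) (ν * s) y - oseenDuhamel ν 0 u u s y‖ +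
          ‖forceDuhamel ν 0 g s y‖ := norm_add_le _ _
      _ ≤ (‖UnboundedOperators.heatExtension (u 0) (ν * s) y‖ + ‖oseenDuhamel ν 0 u u s y‖) +
          ‖forceDuhamel ν 0 g s y‖ := by gcongr; exact norm_sub_le _ _
      _ ≤ (N * (ν * s) ^ (-(3 / (2 * r))) +
          C₁ * ν ^ (-(1 / 2 : ℝ)) * (∫ τ in Ioo 0 s, (s - τ) ^ (-(1 / 2 : ℝ)) * V τ ^ 2)) + s * G :=
          add_le_add (add_le_add hh1 (hB y)) (hF y)
  exact forall_norm_le_of_ae_norm_le (hslc s hsI) hae x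

/-- **The forced short-time sup bound («Hmin»)**: there is a universal `C_B > 0` such that for every
`ν > 0`, `T > 0`, every classical solution `(u, p)` on `[0, T] × ℝ³` driven by a jointly continuous
force `g` (slices bounded by `G`, weakly divergence free, `‖g(τ)‖₂ ≤ G₂ < ∞`), with finite energy,
`‖u‖ ≤ M` on the slab and `‖u(0, ·)‖ ≤ A`:
`‖u(s, x)‖ ≤ A + C_B M² ν^{-1/2} (2√s) + s G` for all `s ∈ (0, T]`, all `x`
(heat term: maximum principle; Duhamel term: `exists_norm_oseenDuhamel_bounded_le`; force term:
`norm_forceDuhamel_le`). Leray 1934, §19 (3.4): the a-priori sup-norm control over the `L^∞`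
window, here WITH a force (Lemarié-Rieusset 2016, Thm. 11.2, the mechanism behind (11.11)); in the
cell `ns-blowup` this is the engine lemma «Hmin» of memo EC-BRIDGE-v5 §4(b).
[cite: Leray1934, §19 (3.4)–(3.8)] [cite: LemarieRieusset2016, Thm. 11.2 (11.11) with Thm. 6.1] -/
theorem exists_norm_le_sup_add_sqrt_add_force :
    ∃ C_B : ℝ, 0 < C_B ∧ ∀ {ν T M G A : ℝ}
      {g u : ℝ → EuclideanSpace ℝ (Fin 3) → EuclideanSpace ℝ (Fin 3)}
      {p : ℝ → EuclideanSpace ℝ (Fin 3) → ℝ} {G₂ : ℝ≥0∞},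
      0 < ν → 0 < T →
      IsClassicalNSSolutionOn (Icc 0 T) ν g u p → Continuous (uncurry g) →
      (∀ τ ∈ Icc 0 T, ∀ y, ‖g τ y‖ ≤ G) → (∀ τ ∈ Icc 0 T, IsWeaklyDivFree (g τ)) → G₂ ≠ ⊤ →
      (∀ τ ∈ Icc 0 T, eLpNorm (g τ) 2 volume ≤ G₂) →
      (∃ C : ℝ≥0∞, C < ⊤ ∧ ∀ t ∈ Icc 0 T, ∫⁻ x, ‖u t x‖ₑ ^ 2 ≤ C) →
      0 < M → (∀ s ∈ Icc 0 T, ∀ y, ‖u s y‖ ≤ M) → (∀ y, ‖u 0 y‖ ≤ A) →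
      ∀ s ∈ Ioc 0 T, ∀ x,
        ‖u s x‖ ≤ A + C_B * M ^ 2 * ν ^ (-(1 / 2 : ℝ)) * (2 * Real.sqrt s) + s * G := by
  obtain ⟨CB, hCB, hCBle⟩ := exists_norm_oseenDuhamel_bounded_le (E := EuclideanSpace ℝ (Fin 3))
  refine ⟨CB, hCB, ?_⟩
  intro ν T M G A g u p G₂ hν hT hcl hgc hG hgdiv hG₂ hg2 hE hM hMb hA s hs x
  have hs0 : 0 < s := hs.1
  have hνs : 0 < ν * s := mul_pos hν hs0
  have hsI : s ∈ Icc 0 T := ⟨hs.1.le, hs.2⟩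
  have h0I : (0 : ℝ) ∈ Icc 0 T := ⟨le_rfl, hT.le⟩
  have hslc : ∀ τ ∈ Icc 0 T, Continuous (u τ) := fun τ hτ =>
    (hcl.contDiff_velocity hτ).continuous
  -- ### the representation formula at time `s`
  have hrep := hcl.ae_eq_forced_oseenMild hν hT hgc hG hgdiv hG₂ hg2 hE hM hMb hs
  -- ### the three terms
  have hheat : ∀ y, ‖UnboundedOperators.heatExtension (u 0) (ν * s) y‖ ≤ A := fun y =>
    UnboundedOperators.norm_heatExtension_le hA hνs y
  have hB : ∀ y, ‖oseenDuhamel ν 0 u u s y‖ ≤ CB * M ^ 2 * ν ^ (-(1 / 2 : ℝ)) * (2 * Real.sqrt s) := by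
    intro y
    have h := hCBle hν hs0 hM.le (fun τ hτ z => hMb τ ⟨hτ.1.le, hτ.2.le.trans hs.2⟩ z)
      (fun τ hτ z => hMb τ ⟨hτ.1.le, hτ.2.le.trans hs.2⟩ z) y
    simpa using h
  have hF : ∀ y, ‖forceDuhamel ν 0 g s y‖ ≤ s * G := by
    intro y
    have h := norm_forceDuhamel_le (g := g) hν hs0.le
      (fun τ hτ z => hG τ ⟨hτ.1.le, hτ.2.le.trans hs.2⟩ z) y
    simpa using h
  -- ### the bound a.e., then everywhere by continuity of `u s`
  have hae : ∀ᵐ y ∂(volume : Measure (EuclideanSpace ℝ (Fin 3))),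
      ‖u s y‖ ≤ A + CB * M ^ 2 * ν ^ (-(1 / 2 : ℝ)) * (2 * Real.sqrt s) + s * G := by
    filter_upwards [hrep] with y hy
    rw [hy]
    calc ‖UnboundedOperators.heatExtension (u 0) (ν * s) y - oseenDuhamel ν 0 u u s y +
          forceDuhamel ν 0 g s y‖
        ≤ ‖UnboundedOperators.heatExtension (u 0) (ν * s) y - oseenDuhamel ν 0 u u s y‖ +
          ‖forceDuhamel ν 0 g s y‖ := norm_add_le _ _
      _ ≤ (‖UnboundedOperators.heatExtension (u 0) (ν * s) y‖ + ‖oseenDuhamel ν 0 u u s y‖) +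
          ‖forceDuhamel ν 0 g s y‖ := by gcongr; exact norm_sub_le _ _
      _ ≤ (A + CB * M ^ 2 * ν ^ (-(1 / 2 : ℝ)) * (2 * Real.sqrt s)) + s * G :=
          add_le_add (add_le_add (hheat y) (hB y)) (hF y)
  exact forall_norm_le_of_ae_norm_le (hslc s hsI) hae x

end Classical

end Literature.Analysis.FluidPDE

end
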